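import Literature.AlgebraicGeometry.AbelianSchemes.FrobeniusVersusHeckeSerreTensor
import Literature.AlgebraicGeometry.AbelianSchemes.AbelianSchemeQuotientPolarizationPullbackDesc
import Literature.AlgebraicGeometry.Motives.AbelianVarietyVerschiebung
import HarnessLib

/-!
# (σ2-CORE-λ) The Frobenius-vs-Hecke isomorphism `E : A^{(q)} ≅ B` is polarised: `E ≫ λ_B ≫ E^∨ = λ^{(q)}`

Topic `Literature/AlgebraicGeometry/AbelianSchemes`, namespace `Literature.AlgebraicGeometry.AbelianSchemes.AbelianSchemeOver` (THEOREMS ONLY; no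
definition, no named fact, no `sorry`, no `instance`, no notation).  Cell `hodgecm-mathlib`, F0/P6 «MOD», sequel to ★ (σ2-CORE)
`FrobeniusVersusHeckeSerreTensor` (p846334): the λ-clause of the σ2 = (β′) spine of `stub_HFROB` (desk F0P6a-plan D-2∕D-3: «`λ` EXACT via descent of `p·λ` to the
quotient then Serre transport … composite `p`-power quasi-isogeny iso on `p^∞` ⇒ honest EXACT tuple iso»), over ABSTRACT binders; `--supports
stmt-HodgeConjecture-24832`, count-neutral.  HC_CM is proved only modulo the 2 remaining named inputs (hLiu418, h413) until rung 0 closes; this file discharges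
none of them.

## Mathematics

Setting of ★ (σ2-CORE) §4 over a field `k` of exponential characteristic `p`, `q = pⁿ`: `(A, ι)`, `(B, ι_B)` abelian varieties with `𝒪`-actions,
`ψ_𝔭 : B → B♭ := B ⊗ 𝔭⁻¹` an ideal translation, `ρ′ : A → B♭` a homomorphism (the Hecke datum; no fppf hypothesis is needed in this file), `F = F_{A/k,q} : A → A^{(q)}`, and an
isomorphism `E : A^{(q)} ≅ B` of abelian `k`-schemes with **`F ≫ E ≫ ψ_𝔭 = ρ′ ≫ ι♭(π₀)`** (★ `exists_iso_relFrobeniusHom_comp_comp_serreTranslate_eq`).  Fix dual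
pairs `(Â, 𝒫_A)`, `(B̂♭, 𝒫♭)`, `(B̂, 𝒫_B)` (★ `DualPair`, unit hypotheses) and homomorphisms `λ_A : A → Â`, `λ♭ : B♭ → B̂♭`, `λ_B : B → B̂` such that
  (h1) `ρ′^* λ♭ = M₁·λ_A` (`ρ′ ≫ λ♭ ≫ ρ′^∨ = λ_A ≫ [M₁]`; model: descent of `p·λ` to the Hecke quotient, `M₁ = p`),
  (h2) `ψ_𝔭^* λ♭ = M₂·λ_B` (model: the Serre cover's exact normalisation, (O-α)∕(O-γ) ★ `IsExactTwistPol`),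
  (Rosati) `ι♭(π₁) ≫ λ♭ = λ♭ ≫ ι♭(π₀)^∨` with `π₀ π₁ = N` (model: `π₁ = π̄₀`, `N = q`),
and `M₁·N = q·M₂`, `M₂ ≠ 0`.  THEN **`E ≫ λ_B ≫ E^∨ = λ^{(q)}`** (`λ^{(q)} = λ_A ×_k Frobⁿ`, ★ `baseChangeHom`): `E` is an isomorphism of POLARISED
`𝒪`-abelian varieties `(A^{(q)}, ι^{(q)}, λ^{(q)}) ≅ (B, ι_B, λ_B)`.  PROOF: pull `λ♭` back along the two sides of `F ≫ E ≫ ψ_𝔭 = ρ′ ≫ ι♭(π₀)` — the left side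
gives `((F≫E)^*λ_B)·M₂` by (h2), the right side `λ_A·M₁N` by Rosati (§1: `ι(π₀)^*λ = N·λ`) and (h1); with `M₁N = qM₂` and torsion-freeness (★
`cancel_right_of_comp_eq_pow_id`) `(F≫E)^*λ_B = q·λ_A = F^*λ^{(q)}` (★ (DF-2) `relFrobeniusHom_comp_baseChangeHom_comp_dualIsogenyOver`), and ★ (λ) polarised
recognition (`comp_lam_comp_dualIsogenyOver_eq_of_pullback_eq`: `F` an fppf cover, `F^∨` quasi-invertible through any `V` with `F ≫ V = [M]`, e.g. the
Verschiebung ★ `existsUnique_relFrobenius_comp_eq_pow_zsmul_id`) concludes.  ([MumfordAV1970] §23; [RapoportSmithlingZhang2020Diagonal] (4.23)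
`p^{2δ}λ = φ^∨λ′φ`; [Shimura1998] §13.1.)

## Contents

* §1 `RingAction.i_comp_lam_comp_dualIsogenyOver_i_eq_of_mul_eq` (Rosati ⇒ `ι(π₀) ≫ λ ≫ ι(π₀)^∨ = λ ≫ [N]`, any base),
  `comp_relFrobeniusHom_eq_pow_id_of` (`F ≫ V = [M] ⇒ V ≫ F = [M]`), `exists_relFrobeniusHom_comp_eq_pow_id` (the Verschiebung: `F ≫ V = [pⁿ]`, `k` perfect);
  `[a] ≫ [b] = [a·b]` is ★ `mulN_comp_mulN`.
* §2 `pullback_lam_eq_of_frobenius_eq_hecke` (`((F≫E) ≫ λ_B ≫ (F≫E)^∨) ≫ [M₂] = λ_A ≫ [M₁·N]`),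
  **`comp_lam_comp_dualIsogenyOver_eq_baseChangeHom_of_frobenius_eq_hecke`** (σ2-CORE-λ: `E ≫ λ_B ≫ E^∨ = λ^{(q)}`).

## References
* [MumfordAV1970] D. Mumford, *Abelian Varieties* (1970), §15 Thm. 1 (p. 143), §20–§21 (Rosati), §23 (p. 231).
* [RapoportSmithlingZhang2020Diagonal] M. Rapoport, B. Smithling, W. Zhang (2020), §4.3 (p. 20), (4.23) (p. 21).
* [Shimura1998] G. Shimura, *Abelian Varieties with Complex Multiplication and Modular Functions* (1998), §13.1 Thm. 1 (pp. 97–99).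
* [Liu2021] Y. Liu (2021), Prop. D.8 (3) (p. 135).
* [Kottwitz1992] R. Kottwitz, JAMS 5 (1992), §5 (p. 390) (Rosati condition `ι(a)^* = ι(ā)`).
* Tree: ★ `FrobeniusVersusHeckeSerreTensor` (σ2-CORE), ★ `RelFrobeniusVersusEndomorphism` §3 (template), ★ `AbelianSchemeHomDescentPolarized` (λ),
  ★ `SerreTensorFrobeniusTwistPolarization` §1 (DF-2 retyped), ★ `DualIsogenyQuasiInverse`, ★ `AbelianSchemeDualIsogenyComp`, ★ `DualIsogenyMulN`,
  ★ `AbelianSchemeQuotientPolarizationPullbackDesc` (`mulN_comp_mulN`), ★ `Motives/AbelianVarietyVerschiebung` + ★ `hom_zsmul_id`.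
-/

noncomputable section

universe u

open CategoryTheory CategoryTheory.Limits AlgebraicGeometry MonoidalCategory CartesianMonoidalCategory
open scoped MonObj

namespace Literature.AlgebraicGeometry.AbelianSchemes

namespace AbelianSchemeOver

/-! ## §1 Rosati scalar lemma (any base) and the quasi-inverse of `F` -/

section Rosati

variable {S : Scheme.{u}} {X : AbelianSchemeOver S} {O : Type*} [CommRing O] (actX : X.RingAction O) (DX : X.DualPair)
  (lamX : X.X ⟶ DX.hat.X) [IsMonHom lamX]

/-- **`ι(π₀) ≫ λ ≫ ι(π₀)^∨ = λ ≫ [N]`** under the Rosati compatibility `ι(π₁) ≫ λ = λ ≫ ι(π₀)^∨` and `π₀ π₁ = N` — ANY base, any `𝒪`-abelian scheme (★ FROB₀-organ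
§3 `RingAction.i_comp_lam_comp_dualIsogenyOver_i_eq` is the case of an abelian variety `A₀`). [cite: MumfordAV1970, §20–§21 (Rosati involution)]
[cite: Kottwitz1992, §5 (p. 390)] -/
theorem RingAction.i_comp_lam_comp_dualIsogenyOver_i_eq_of_mul_eq {π₀ π₁ : O} {N : ℕ} (hq : π₀ * π₁ = (N : O))
    (hros : actX.i π₁ ≫ lamX = lamX ≫ @DualPair.dualIsogenyOver _ _ _ (actX.i π₀) (actX.isMonHom π₀) DX DX) :
    actX.i π₀ ≫ lamX ≫ @DualPair.dualIsogenyOver _ _ _ (actX.i π₀) (actX.isMonHom π₀) DX DX = lamX ≫ DX.hat.mulN N := by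
  rw [← hros, ← Category.assoc, ← actX.i_mul, mul_comm, hq, RingAction.i_natCast, mulN_def, comp_pow_id_eq_pow_id_comp X lamX N]

end Rosati

section Frobenius

open Literature.AlgebraicGeometry.Motives Literature.AlgebraicGeometry.Motives.AbelianVariety

variable {k : Type u} [Field k] (p : ℕ) [ExpChar k p] (n : ℕ) {A : AbelianVariety k} [IsMonHom (relFrobeniusHom p n A)]
  (V : (AbelianScheme.ofAbelianVariety (A.frobeniusTwist p n)).toOver.X ⟶ (AbelianScheme.ofAbelianVariety A).toOver.X)

/-- `F ≫ V = [M]_A ⇒ V ≫ F = [M]_{A^{(q)}}` (cancel the fppf epimorphism `F` on the left of `F ≫ V ≫ F = [M] ≫ F = F ≫ [M]`); e.g. `V` = the Verschiebung of ★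
`existsUnique_relFrobenius_comp_eq_pow_zsmul_id`. [cite: MumfordAV1970, §15 (p. 146)] [cite: MumfordAV1970, §7 Thm. 4 (p. 72)] -/
theorem comp_relFrobeniusHom_eq_pow_id_of {M : ℕ}
    (hV : relFrobeniusHom p n A ≫ V = (𝟙 (AbelianScheme.ofAbelianVariety A).toOver.X) ^ M) :
    V ≫ relFrobeniusHom p n A = (𝟙 (AbelianScheme.ofAbelianVariety (A.frobeniusTwist p n)).toOver.X) ^ M := by
  haveI := isFinite_relFrobeniusHom_left p n A
  haveI := flat_relFrobeniusHom_left p n A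
  haveI := surjective_relFrobeniusHom_left p n A
  apply cancel_left_of_flat_surjective (AbelianScheme.ofAbelianVariety A).toOver
    (C := (AbelianScheme.ofAbelianVariety (A.frobeniusTwist p n)).toOver) (relFrobeniusHom p n A)
  rw [← Category.assoc, hV]
  exact (comp_pow_id_eq_pow_id_comp (AbelianScheme.ofAbelianVariety A).toOver (relFrobeniusHom p n A) M).symm

omit [IsMonHom (relFrobeniusHom p n A)] in
/-- **The Verschiebung supplies `V` with `F ≫ V = [q]`** in the `relFrobeniusHom` currency: over a perfect field of characteristic `p` there is a homomorphism
`V : A^{(q)} → A` of abelian `k`-schemes with `F_{A/k,q} ≫ V = [pⁿ]_A` (★ `existsUnique_relFrobenius_comp_eq_pow_zsmul_id`, ★ `hom_zsmul_id`) — the `hV` input of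
§2. [cite: MumfordAV1970, §15 (p. 146)] [cite: Shimura1998, §2.8 Prop. 6 (i) (p. 16)] -/
theorem exists_relFrobeniusHom_comp_eq_pow_id [PerfectField k] [Fact p.Prime] [CharP k p] :
    ∃ V : (AbelianScheme.ofAbelianVariety (A.frobeniusTwist p n)).toOver.X ⟶ (AbelianScheme.ofAbelianVariety A).toOver.X,
      IsMonHom V ∧ relFrobeniusHom p n A ≫ V = (𝟙 (AbelianScheme.ofAbelianVariety A).toOver.X) ^ (p ^ n) := by
  obtain ⟨V, hV, -⟩ := A.existsUnique_relFrobenius_comp_eq_pow_zsmul_id p n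
  refine ⟨V.hom.hom.hom, inferInstanceAs (IsMonHom V.hom.hom.hom), ?_⟩
  have h := congrArg (fun f : A ⟶ A => f.hom.hom.hom) hV
  simp only at h
  rw [hom_zsmul_id, zpow_natCast] at h
  exact h

end Frobenius

/-! ## §2 (σ2-CORE-λ) `E ≫ λ_B ≫ E^∨ = λ^{(q)}` -/

section Polarized

open Literature.AlgebraicGeometry.Motives Literature.AlgebraicGeometry.Motives.AbelianVariety

variable {k : Type u} [Field k] (p : ℕ) [ExpChar k p] (n : ℕ) {A B : AbelianVariety k} {O : Type*} [CommRing O]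
  [IsMonHom (relFrobeniusHom p n A)]
  (actB : (AbelianScheme.ofAbelianVariety B).toOver.RingAction O) [IsCommMonObj (AbelianScheme.ofAbelianVariety B).toOver.X]
  {m₁ : ℕ} (E₁ : Matrix (Fin m₁) (Fin m₁) O) (hE₁ : E₁ * E₁ = E₁) (P₁ : Matrix (Fin m₁) (Fin 1) O) [IsMonHom (serreTranslate actB E₁ hE₁ P₁)]
  (ρ' : (AbelianScheme.ofAbelianVariety A).toOver.X ⟶ (serreTensor actB E₁ hE₁).X) [IsMonHom ρ']
  -- dual pairs and polarisation homomorphisms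
  (DA : (AbelianScheme.ofAbelianVariety A).toOver.DualPair)
  (hDA : Nonempty ((Scheme.Modules.pullback (DualPair.unitHatSlice DA)).obj DA.P ≅ SheafOfModules.unit _))
  (lamA : (AbelianScheme.ofAbelianVariety A).toOver.X ⟶ DA.hat.X) [IsMonHom lamA]
  (Db : (serreTensor actB E₁ hE₁).DualPair)
  (hDb : Nonempty ((Scheme.Modules.pullback (DualPair.unitHatSlice Db)).obj Db.P ≅ SheafOfModules.unit _))
  (lamb : (serreTensor actB E₁ hE₁).X ⟶ Db.hat.X) [IsMonHom lamb]
  (DB : (AbelianScheme.ofAbelianVariety B).toOver.DualPair)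
  (hDB : Nonempty ((Scheme.Modules.pullback (DualPair.unitHatSlice DB)).obj DB.P ≅ SheafOfModules.unit _))
  (lamB : (AbelianScheme.ofAbelianVariety B).toOver.X ⟶ DB.hat.X) [IsMonHom lamB]
  (E : (AbelianScheme.ofAbelianVariety (A.frobeniusTwist p n)).toOver.X ≅ (AbelianScheme.ofAbelianVariety B).toOver.X) [IsMonHom E.hom]

include hDA hDb hDB

omit [IsMonHom lamA] [IsMonHom lamB] in
/-- **The two pull-backs of `λ♭` along `F ≫ E ≫ ψ_𝔭 = ρ′ ≫ ι♭(π₀)`**: `((F ≫ E) ≫ λ_B ≫ (F ≫ E)^∨) ≫ [M₂] = λ_A ≫ [M₁·N]` — left side through (h2)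
`ψ_𝔭 ≫ λ♭ ≫ ψ_𝔭^∨ = λ_B ≫ [M₂]`, right side through Rosati (§1) and (h1) `ρ′ ≫ λ♭ ≫ ρ′^∨ = λ_A ≫ [M₁]` (★ `dualIsogenyOver_comp`, ★ `dualIsogenyOver_congr`).
[cite: MumfordAV1970, §15 Thm. 1 (p. 143)] [cite: RapoportSmithlingZhang2020Diagonal, §4.3 (p. 20), (4.23) (p. 21)] -/
theorem pullback_lam_eq_of_frobenius_eq_hecke {π₀ π₁ : O} {N M₁ M₂ : ℕ} (hπ : π₀ * π₁ = (N : O))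
    (he : relFrobeniusHom p n A ≫ E.hom ≫ serreTranslate actB E₁ hE₁ P₁ = ρ' ≫ (serreAction actB E₁ hE₁).i π₀)
    (hros : (serreAction actB E₁ hE₁).i π₁ ≫ lamb =
      lamb ≫ @DualPair.dualIsogenyOver _ _ _ ((serreAction actB E₁ hE₁).i π₀) ((serreAction actB E₁ hE₁).isMonHom π₀) Db Db)
    (h1 : ρ' ≫ lamb ≫ DualPair.dualIsogenyOver ρ' DA Db = lamA ≫ DA.hat.mulN M₁)
    (h2 : serreTranslate actB E₁ hE₁ P₁ ≫ lamb ≫ DualPair.dualIsogenyOver (serreTranslate actB E₁ hE₁ P₁) DB Db = lamB ≫ DB.hat.mulN M₂) :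
    ((relFrobeniusHom p n A ≫ E.hom) ≫ lamB ≫ DualPair.dualIsogenyOver (relFrobeniusHom p n A ≫ E.hom) DA DB) ≫ DA.hat.mulN M₂ =
      lamA ≫ DA.hat.mulN (M₁ * N) := by
  haveI := (serreAction actB E₁ hE₁).isMonHom π₀
  haveI := DualPair.isMonHom_dualIsogenyOver (relFrobeniusHom p n A ≫ E.hom) DA DB hDB hDA
  haveI := DualPair.isMonHom_dualIsogenyOver ρ' DA Db hDb hDA
  -- the common value `T := Φ ≫ λ♭ ≫ Φ^∨`, `Φ = (F ≫ E) ≫ ψ_𝔭 = ρ′ ≫ ι♭(π₀)`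
  have he' : (relFrobeniusHom p n A ≫ E.hom) ≫ serreTranslate actB E₁ hE₁ P₁ = ρ' ≫ (serreAction actB E₁ hE₁).i π₀ := by
    rw [Category.assoc]; exact he
  -- left reading: through `ψ_𝔭` and (h2)
  have hL : ((relFrobeniusHom p n A ≫ E.hom) ≫ serreTranslate actB E₁ hE₁ P₁) ≫ lamb ≫
      DualPair.dualIsogenyOver ((relFrobeniusHom p n A ≫ E.hom) ≫ serreTranslate actB E₁ hE₁ P₁) DA Db =
        ((relFrobeniusHom p n A ≫ E.hom) ≫ lamB ≫ DualPair.dualIsogenyOver (relFrobeniusHom p n A ≫ E.hom) DA DB) ≫ DA.hat.mulN M₂ := by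
    rw [DualPair.dualIsogenyOver_comp (relFrobeniusHom p n A ≫ E.hom) (serreTranslate actB E₁ hE₁ P₁) DA DB Db]
    simp only [Category.assoc]
    rw [← Category.assoc lamb, ← Category.assoc (serreTranslate actB E₁ hE₁ P₁), ← Category.assoc (serreTranslate actB E₁ hE₁ P₁)]
    rw [show (serreTranslate actB E₁ hE₁ P₁ ≫ lamb) ≫ DualPair.dualIsogenyOver (serreTranslate actB E₁ hE₁ P₁) DB Db = lamB ≫ DB.hat.mulN M₂ by
      rw [Category.assoc]; exact h2]
    rw [Category.assoc, mulN_def, mulN_def,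
      ← comp_pow_id_eq_pow_id_comp DB.hat (DualPair.dualIsogenyOver (relFrobeniusHom p n A ≫ E.hom) DA DB) M₂]
  -- right reading: through `ι♭(π₀)`, Rosati and (h1)
  have hR : (ρ' ≫ (serreAction actB E₁ hE₁).i π₀) ≫ lamb ≫ DualPair.dualIsogenyOver (ρ' ≫ (serreAction actB E₁ hE₁).i π₀) DA Db =
      lamA ≫ DA.hat.mulN (M₁ * N) := by
    rw [DualPair.dualIsogenyOver_comp ρ' ((serreAction actB E₁ hE₁).i π₀) DA Db Db]
    simp only [Category.assoc]
    rw [← Category.assoc lamb, ← Category.assoc ((serreAction actB E₁ hE₁).i π₀), ← Category.assoc ((serreAction actB E₁ hE₁).i π₀)]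
    rw [show ((serreAction actB E₁ hE₁).i π₀ ≫ lamb) ≫ DualPair.dualIsogenyOver ((serreAction actB E₁ hE₁).i π₀) Db Db = lamb ≫ Db.hat.mulN N by
      rw [Category.assoc]; exact RingAction.i_comp_lam_comp_dualIsogenyOver_i_eq_of_mul_eq (serreAction actB E₁ hE₁) Db lamb hπ hros]
    rw [Category.assoc, mulN_def, ← comp_pow_id_eq_pow_id_comp Db.hat (DualPair.dualIsogenyOver ρ' DA Db) N, ← Category.assoc lamb,
      ← Category.assoc ρ', ← mulN_def]
    rw [h1, Category.assoc, mulN_comp_mulN DA.hat]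
  -- the two readings agree by `he'`
  have hcongr : ((relFrobeniusHom p n A ≫ E.hom) ≫ serreTranslate actB E₁ hE₁ P₁) ≫ lamb ≫
      DualPair.dualIsogenyOver ((relFrobeniusHom p n A ≫ E.hom) ≫ serreTranslate actB E₁ hE₁ P₁) DA Db =
        (ρ' ≫ (serreAction actB E₁ hE₁).i π₀) ≫ lamb ≫ DualPair.dualIsogenyOver (ρ' ≫ (serreAction actB E₁ hE₁).i π₀) DA Db := by
    rw [DualPair.dualIsogenyOver_congr DA Db (ψ₁ := (relFrobeniusHom p n A ≫ E.hom) ≫ serreTranslate actB E₁ hE₁ P₁)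
      (ψ₂ := ρ' ≫ (serreAction actB E₁ hE₁).i π₀) he', he']
  rw [← hL, hcongr, hR]

-- `A^{(q)}.X` vs `(A₀.baseChange Frobⁿ).X` (the carrier of ★ `baseChangeHom`) agree only semireducibly (as in ★ FROB₀-organ §3).
set_option backward.isDefEq.respectTransparency false in
/-- **(σ2-CORE-λ) `E ≫ λ_B ≫ E^∨ = λ^{(q)}`.**  In the setting of ★ (σ2-CORE) §4 (`F ≫ E ≫ ψ_𝔭 = ρ′ ≫ ι♭(π₀)`), with homomorphisms `λ_A`, `λ♭`, `λ_B` into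
dual abelian schemes satisfying (h1) `ρ′ ≫ λ♭ ≫ ρ′^∨ = λ_A ≫ [M₁]`, (h2) `ψ_𝔭 ≫ λ♭ ≫ ψ_𝔭^∨ = λ_B ≫ [M₂]`, the Rosati compatibility `ι♭(π₁) ≫ λ♭ = λ♭ ≫ ι♭(π₀)^∨`
with `π₀ π₁ = N`, the scalar identity `M₁·N = pⁿ·M₂`, `M₂ ≠ 0`, and ANY `V : A^{(q)} → A` with `F ≫ V = [M]`, `M ≠ 0` (e.g. the Verschiebung), the isomorphism
`E : A^{(q)} ≅ B` carries `λ_B` to the Frobenius-twisted polarisation: **`E ≫ λ_B ≫ E^∨_{D_A^{(q)}, D_B} = λ_A^{(q)}`** (`= baseChangeHom λ_A (Spec Frobⁿ)`) — so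
`(A^{(q)}, ι^{(q)}, λ^{(q)}) ≅ (B, ι_B, λ_B)` as POLARISED `𝒪`-abelian varieties (★ (λ) polarised recognition along the fppf cover `F`: both pull-backs to `A`
are `λ_A ≫ [q]` by §2 `pullback_lam_eq_of_frobenius_eq_hecke`, ★ `cancel_right_of_comp_eq_pow_id` and ★ (DF-2)). [cite: MumfordAV1970, §23 (p. 231)]
[cite: MumfordAV1970, §15 Thm. 1 (p. 143)] [cite: RapoportSmithlingZhang2020Diagonal, §4.3 (p. 20), (4.23) (p. 21)] [cite: Shimura1998, §13.1 Thm. 1 (pp. 97–99)]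
[cite: Liu2021, Prop. D.8 (3) (p. 135)] -/
theorem comp_lam_comp_dualIsogenyOver_eq_baseChangeHom_of_frobenius_eq_hecke {π₀ π₁ : O} {N M₁ M₂ M : ℕ} (hπ : π₀ * π₁ = (N : O))
    (he : relFrobeniusHom p n A ≫ E.hom ≫ serreTranslate actB E₁ hE₁ P₁ = ρ' ≫ (serreAction actB E₁ hE₁).i π₀)
    (hros : (serreAction actB E₁ hE₁).i π₁ ≫ lamb =
      lamb ≫ @DualPair.dualIsogenyOver _ _ _ ((serreAction actB E₁ hE₁).i π₀) ((serreAction actB E₁ hE₁).isMonHom π₀) Db Db)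
    (h1 : ρ' ≫ lamb ≫ DualPair.dualIsogenyOver ρ' DA Db = lamA ≫ DA.hat.mulN M₁)
    (h2 : serreTranslate actB E₁ hE₁ P₁ ≫ lamb ≫ DualPair.dualIsogenyOver (serreTranslate actB E₁ hE₁ P₁) DB Db = lamB ≫ DB.hat.mulN M₂)
    (hMN : M₁ * N = p ^ n * M₂) (hM₂ : M₂ ≠ 0)
    (V : (AbelianScheme.ofAbelianVariety (A.frobeniusTwist p n)).toOver.X ⟶ (AbelianScheme.ofAbelianVariety A).toOver.X) [IsMonHom V] (hM : M ≠ 0)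
    (hV : relFrobeniusHom p n A ≫ V = (𝟙 (AbelianScheme.ofAbelianVariety A).toOver.X) ^ M) :
    E.hom ≫ lamB ≫ DualPair.dualIsogenyOver E.hom (DA.frobeniusTwist p n A) DB =
      baseChangeHom (A := (AbelianScheme.ofAbelianVariety A).toOver) (B := DA.hat) lamA (frobSpec k p n) := by
  haveI := isFinite_relFrobeniusHom_left p n A
  haveI := flat_relFrobeniusHom_left p n A
  haveI := surjective_relFrobeniusHom_left p n A
  haveI := isMonHom_baseChangeHom (A := (AbelianScheme.ofAbelianVariety A).toOver) (B := DA.hat) lamA (frobSpec k p n)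
  have hDq := DA.nonempty_unitHatSlice_frobeniusTwist_iso p n A hDA
  haveI := DualPair.isMonHom_dualIsogenyOver E.hom (DA.frobeniusTwist p n A) DB hDB hDq
  haveI := DualPair.isMonHom_dualIsogenyOver (relFrobeniusHom p n A ≫ E.hom) DA DB hDB hDA
  haveI : IsCommMonObj DA.hat.X := DA.hat.isCommMonObj_of_isReduced_base
  haveI := DA.hat.isMonHom_mulN (p ^ n)
  refine comp_lam_comp_dualIsogenyOver_eq_of_pullback_eq (relFrobeniusHom p n A) DA DB (DA.frobeniusTwist p n A) E lamB
    (baseChangeHom (A := (AbelianScheme.ofAbelianVariety A).toOver) (B := DA.hat) lamA (frobSpec k p n))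
    (DualPair.dualIsogenyOver V (DA.frobeniusTwist p n A) DA) hM
    (dualIsogenyOver_comp_dualIsogenyOver_eq_pow_id (relFrobeniusHom p n A) V DA (DA.frobeniusTwist p n A) hDq
      (comp_relFrobeniusHom_eq_pow_id_of p n V hV)) ?_
  -- both pull-backs along `F` are `λ_A ≫ [q]`: cancel `[M₂]` on the right of §2's identity
  rw [relFrobeniusHom_comp_baseChangeHom_comp_dualIsogenyOver p n A DA hDA lamA]
  symm
  refine cancel_right_of_comp_eq_pow_id (AbelianScheme.ofAbelianVariety A).toOver (DA.hat.mulN M₂) (𝟙 DA.hat.X) hM₂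
    (by rw [Category.comp_id, mulN_def]) _ _ ?_
  rw [pullback_lam_eq_of_frobenius_eq_hecke p n actB E₁ hE₁ P₁ ρ' DA hDA lamA Db hDb lamb DB hDB lamB E hπ he hros h1 h2, hMN,
    Category.assoc, mulN_comp_mulN DA.hat]

end Polarized

end AbelianSchemeOver

end Literature.AlgebraicGeometry.AbelianSchemes

end
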